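import Mathlib
import Literature.NumberTheory.LFunctions.RiemannXi
import Literature.Analysis.Complex.JensenPolynomialHyperbolicity
import Literature.GroupTheory.PermutationGroups.SmallIndexSubgroups

/-!
# The exponential gauge of Jensen polynomials

If `F(x) = Σ γ(m) x^m/m!` and `F_a(x) = e^{a x} F(x) = Σ γ_a(m) x^m/m!`, then `γ_a(m) = Σ_i (m choose i) a^{m-i} γ(i)` and
for every degree `d`

  `J^{d,0}_{γ_a}(X) = Σ_k (d choose k) γ(k) X^k (1 + aX)^{d-k}`, i.e. `J^{d,0}_{γ_a}(X) = (1 + aX)^d · J^{d,0}_γ(X/(1 + aX))`.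

So the zeros of `J^{d,0}_{γ_a}` are the images of those of `J^{d,0}_γ` under the real Möbius map `Y ↦ Y/(1 - aY)`:
twisting an entire function by `e^{ax}` (real `a`) changes none of the hyperbolicity thresholds of its shift-0 Jensen
polynomials, although it changes the growth data of `F` at will. (Equivalently: `e^{aD}` acts on `F(D)X^d` as the
translation `X ↦ X + a`.) This is the algebra behind the soloist's observation that the degree at which `J^{d,0}`
detects a planted zero pair is governed by the local configuration of zeros and not by function-level size
parameters, and behind the exactness of the sector bound for the background `e^{x}`.

Soloist artefact `solo-RiemannHypothesis-blind`, session 27 (2026-08-20). Mathlib + the tree's `jensenPoly`; no sorries.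
-/

open Polynomial Finset

namespace Summit.RiemannHypothesis.RiemannHypothesis.Theorems

open Literature.NumberTheory.LFunctions (jensenPoly)
open Literature.Analysis.Complex.PolyaSchur

/-- Coefficients of `(1 + aX)^n`. -/
theorem soloBlind_coeff_one_add_CX_pow (a : ℝ) :
    ∀ n m : ℕ, ((1 + C a * X : ℝ[X]) ^ n).coeff m = (n.choose m : ℝ) * a ^ m
  | 0, 0 => by simp
  | 0, m + 1 => by simp [coeff_one]
  | n + 1, 0 => by
      rw [pow_succ, mul_add, mul_one, coeff_add, ← mul_assoc, mul_coeff_zero (((1 + C a * X : ℝ[X]) ^ n) * C a) X,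
        coeff_X_zero, mul_zero, add_zero, soloBlind_coeff_one_add_CX_pow a n 0]
      simp
  | n + 1, m + 1 => by
      rw [pow_succ, mul_add, mul_one, coeff_add, ← mul_assoc, coeff_mul_X, coeff_mul_C,
        soloBlind_coeff_one_add_CX_pow a n (m + 1), soloBlind_coeff_one_add_CX_pow a n m, Nat.choose_succ_succ',
        Nat.cast_add]
      ring

/-- **Exponential gauge.** For every real sequence `γ`, every `a : ℝ` and every `d`:
`J^{d,0}` of the twisted sequence `m ↦ Σ_{i ≤ m} (m choose i) a^{m-i} γ(i)` (the Taylor sequence of `e^{ax}·Σ γ(m)x^m/m!`)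
equals `Σ_{k ≤ d} (d choose k) γ(k) X^k (1 + aX)^{d-k}` `= (1 + aX)^d J^{d,0}_γ(X/(1+aX))`. [folklore] -/
theorem soloBlind_jensenPoly_expTwist (a : ℝ) (γ : ℕ → ℝ) (d : ℕ) :
    jensenPoly (fun m : ℕ => ∑ i ∈ range (m + 1), (m.choose i : ℝ) * a ^ (m - i) * γ i) d 0
      = ∑ k ∈ range (d + 1), C ((d.choose k : ℝ) * γ k) * (X ^ k * (1 + C a * X) ^ (d - k)) := by
  ext j
  simp only [coeff_jensenPoly, zero_add, finsetSum_coeff, coeff_C_mul, coeff_X_pow_mul',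
    soloBlind_coeff_one_add_CX_pow]
  by_cases hj : j ≤ d
  · rw [if_pos hj]
    -- restrict the right-hand sum to k ≤ j
    have hfilter : (range (d + 1)).filter (fun k => k ≤ j) = range (j + 1) := by
      ext k; simp only [mem_filter, mem_range]; omega
    simp only [mul_ite, mul_zero]
    rw [← sum_filter, hfilter, mul_sum]
    refine sum_congr rfl fun k hk => ?_
    have hkj : k ≤ j := Nat.lt_succ_iff.mp (mem_range.mp hk)
    have hmul : (d.choose j : ℝ) * (j.choose k : ℝ) = (d.choose k : ℝ) * ((d - k).choose (j - k) : ℝ) := by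
      exact_mod_cast Nat.choose_mul (n := d) hkj
    linear_combination (a ^ (j - k) * γ k) * hmul
  · rw [if_neg hj]
    symm
    refine sum_eq_zero fun k hk => ?_
    have hkd : k ≤ d := Nat.lt_succ_iff.mp (mem_range.mp hk)
    have hkj : k ≤ j := by omega
    have hlt : d - k < j - k := by omega
    rw [if_pos hkj, Nat.choose_eq_zero_of_lt hlt]
    simp

/-- TRANSLATION FORM: the reversal `X^d J^{d,0}(1/X)` of the twisted Jensen polynomial is the TRANSLATE by `a` of the
reversal of the original one — `e^{aD}` acts on `F(D)X^d` as `X ↦ X + a`. [folklore] -/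
theorem soloBlind_reflect_jensenPoly_expTwist (a : ℝ) (γ : ℕ → ℝ) (d : ℕ) :
    reflect d (jensenPoly (fun m : ℕ => ∑ i ∈ range (m + 1), (m.choose i : ℝ) * a ^ (m - i) * γ i) d 0) = (reflect d (jensenPoly γ d 0)).comp (X + C a) := by
  -- the reversal of `J^{d,0}_γ` as an explicit sum
  have hrev : ∀ δ : ℕ → ℝ, reflect d (jensenPoly δ d 0) = ∑ k ∈ range (d + 1), C ((d.choose k : ℝ) * δ k) * X ^ (d - k) := by
    intro δ
    ext i
    rw [coeff_reflect, coeff_jensenPoly, finsetSum_coeff]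
    simp only [coeff_C_mul_X_pow, zero_add]
    by_cases hi : i ≤ d
    · rw [revAt_le hi, if_pos (Nat.sub_le d i)]
      rw [sum_eq_single (d - i)]
      · rw [if_pos (by omega)]
      · intro k hk hki
        rw [if_neg]; intro h; apply hki; have := mem_range.mp hk; omega
      · intro h; exact absurd (mem_range.mpr (by omega)) h
    · have hi : d < i := not_le.mp hi
      rw [revAt_eq_self_of_lt hi, if_neg (by omega)]
      symm; refine sum_eq_zero fun k hk => ?_
      rw [if_neg]; have := mem_range.mp hk; omega
  rw [hrev, hrev, Polynomial.sum_comp]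
  simp only [mul_comp, C_comp, X_pow_comp]
  ext i
  simp only [finsetSum_coeff, coeff_C_mul, coeff_X_pow, coeff_X_add_C_pow]
  -- left: Σ_k (d choose k) γ_a(k) [i = d-k];  right: Σ_k (d choose k) γ(k) a^{d-k-i} (d-k choose i)
  by_cases hi : i ≤ d
  · rw [sum_eq_single (d - i)]
    · rw [if_pos (by omega), mul_one, mul_sum]
      -- now Σ_{l ≤ d-i} (d choose d-i)(d-i choose l) a^{d-i-l} γ l  =  Σ_{k ≤ d} (d choose k) γ k a^{d-k-i} (d-k choose i)
      have hfilter : (range (d + 1)).filter (fun k => k ≤ d - i) = range (d - i + 1) := by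
        ext k; simp only [mem_filter, mem_range]; omega
      rw [show (∑ k ∈ range (d + 1), (d.choose k : ℝ) * γ k * (a ^ (d - k - i) * ((d - k).choose i : ℝ)))
            = ∑ k ∈ range (d + 1), (if k ≤ d - i then (d.choose k : ℝ) * γ k * (a ^ (d - k - i) * ((d - k).choose i : ℝ)) else 0) from
          sum_congr rfl fun k hk => by
            by_cases hk' : k ≤ d - i
            · rw [if_pos hk']
            · have hz : (d - k).choose i = 0 := Nat.choose_eq_zero_of_lt (by have := mem_range.mp hk; omega)
              rw [if_neg hk', hz]; simp]
      rw [← sum_filter, hfilter]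
      refine sum_congr rfl fun l hl => ?_
      have hl' : l ≤ d - i := Nat.lt_succ_iff.mp (mem_range.mp hl)
      have hc : ((d.choose (d - i) : ℕ) : ℝ) * (((d - i).choose l : ℕ) : ℝ) = ((d.choose l : ℕ) : ℝ) * (((d - l).choose i : ℕ) : ℝ) := by
        rw [Nat.choose_symm hi]; exact_mod_cast Literature.GroupTheory.PermutationGroups.choose_mul_choose_sub d i l
      have he : d - i - l = d - l - i := by omega
      rw [he]
      linear_combination (a ^ (d - l - i) * γ l) * hc
    · intro k hk hki; rw [if_neg (by have := mem_range.mp hk; omega), mul_zero]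
    · intro h; exact absurd (mem_range.mpr (by omega)) h
  · have hi : d < i := not_le.mp hi
    rw [sum_eq_zero, sum_eq_zero]
    · intro k hk
      have hz : (d - k).choose i = 0 := Nat.choose_eq_zero_of_lt (by have := mem_range.mp hk; omega)
      rw [hz]; simp
    · intro k hk; rw [if_neg (by have := mem_range.mp hk; omega), mul_zero]

/-- **Hyperbolicity is gauge invariant.** If `J^{d,0}_γ` is hyperbolic then so is `J^{d,0}` of the twisted sequence
`m ↦ Σ_{i ≤ m} (m choose i) a^{m-i} γ(i)` (Taylor sequence of `e^{ax}F`), for every real `a`: reflect, translate by `a`, reflect back. [folklore] -/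
theorem soloBlind_jensenPoly_expTwist_splits (a : ℝ) (γ : ℕ → ℝ) (d : ℕ) (h : (jensenPoly γ d 0).Splits) :
    (jensenPoly (fun m : ℕ => ∑ i ∈ range (m + 1), (m.choose i : ℝ) * a ^ (m - i) * γ i) d 0).Splits := by
  have h1 : (reflect d (jensenPoly γ d 0)).Splits := splits_reflect h (natDegree_jensenPoly_le γ d 0)
  have h2 : ((reflect d (jensenPoly γ d 0)).comp (X + C a)).Splits := h1.comp_X_add_C a
  rw [← soloBlind_reflect_jensenPoly_expTwist] at h2
  have h3 := splits_reflect h2 (N := d) ?_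
  · have hinv : reflect d (reflect d (jensenPoly (fun m : ℕ => ∑ i ∈ range (m + 1), (m.choose i : ℝ) * a ^ (m - i) * γ i) d 0)) = jensenPoly (fun m : ℕ => ∑ i ∈ range (m + 1), (m.choose i : ℝ) * a ^ (m - i) * γ i) d 0 := by
      ext i; rw [coeff_reflect, coeff_reflect, revAt_invol]
    rwa [hinv] at h3
  · -- natDegree of a reflect at level d is ≤ d
    refine natDegree_le_iff_coeff_eq_zero.mpr fun i hi => ?_
    rw [coeff_reflect, revAt_eq_self_of_lt (by exact_mod_cast hi), coeff_eq_zero_of_natDegree_lt]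
    exact lt_of_le_of_lt (natDegree_jensenPoly_le _ d 0) (by exact_mod_cast hi)

end Summit.RiemannHypothesis.RiemannHypothesis.Theorems
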